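import Literature.AlgebraicGeometry.Surfaces.K3SqrtThreeOfTranscendentalEmbedding
import HarnessLib

/-!
# The algebraic Hodge similitude of multiplier `p` from a K3 surface Hodge isometric to one with a
# symplectic automorphism of order `p ∈ {2, 3}` (Varesco, Math. Z. 305 (2023), §2 "starting observation"
# with Thm. 2.1's first step, Prop. 2.5 and Prop. 2.11) — NAMED FACTS

Family `hodge`, layer `Literature/AlgebraicGeometry/Surfaces`. Two NAMED FACTS (D-0014, statement only),
companions of `Varesco2023_sqrtMultiplication_algebraic_of_symplecticAutomorphism` (reduced form of
Thm. 2.1) and `Varesco2023_sqrtThree_algebraic_of_transcendental_embedding` (Thm. 2.1 ∘ Prop. 2.11):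
they record the INTERMEDIATE OBJECT of Varesco's proof — the algebraic Hodge similitude
`φ = β_*π^* : T(Y) → T(X′)` of multiplier `p` from the minimal resolution `Y` of `X′/σ_p`, composed with
the (algebraic, Buskin–Huybrechts) Hodge isometry `T(X′)_ℚ ⥲ T(X)_ℚ` — for every projective K3
surface `X` satisfying the lattice criterion of Prop. 2.5 (`p = 2`) / Prop. 2.11 (`p = 3`). Consumer:
`Summits/HodgeConjecture/HodgeConjecture/Theorems/MarkmanPartnerTransportPicardThreeK3SquaresSqrtSix*`
(crux `PicardThreeK3Squares`, stmt-HodgeConjecture-19652: `√6 = √2·√3`-multiplication at Picard rank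
`16`, where BOTH lattice criteria are automatic).

## Source (read at this seat; locators = files of the materialised text `paper:arxiv-2304.02519`)

* [Var23] M. Varesco, *Hodge similarities, algebraic classes, and Kuga–Satake varieties*, Math. Z. 305
  (2023), art. 69 = arXiv:2304.02519 [`Varesco2023`; REFEREED]. **§2, the starting observation**
  [p0008:L12–L28, verbatim]: "given a K3 surface `X` with a symplectic automorphism of order `p`, there
  exists a K3 surface `Y` and an algebraic Hodge similarity `φ : T(Y) → T(X)` of multiplier `p`. To show
  this, recall that, by [Huybrechts, Lectures on K3 surfaces], the prime `p` is at most `7`, the fixed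
  locus of `σ_p` is a finite union of points, and the minimal resolution of `X/σ_p` is a K3 surface `Y`.
  […] As `π : X̃ → Y` is a finite map of degree `p` and `β : X̃ → X` just contracts the exceptional
  divisors, we see that `φ ≔ β_*π^* : T(Y) → T(X)` is a Hodge similarity of multiplier `p`. Note that
  `φ` is algebraic." **Thm. 2.1, first sentence of the proof** [p0008:L35]: "As Hodge isometries of K3
  surfaces are algebraic by [Buskin 2019] and [Huybrechts 2019], we may assume that `X` admits a
  symplectic automorphism of order `p`." (i.e. for `X` Hodge isometric to such an `X′`, compose `φ′` with
  the algebraic isometry `T(X′) ⥲ T(X)`; compositions of algebraic correspondences are algebraic).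
  **Prop. 2.5** [p0009:L28–L31, verbatim]: "A K3 surface `X` is Hodge isometric to a K3 surface
  admitting a Nikulin involution if and only if `T(X) ⊆ U³_ℚ ⊕ E₈(−2)_ℚ`." **Prop. 2.11** [p0010:L55–
  L58, verbatim]: "A K3 surface `X` is Hodge isometric to a K3 surface admitting a symplectic
  automorphism of order `3` if and only if `T(X) ⊆ U³_ℚ ⊕ (A₂)²_ℚ`." (both "`⊆`" meaning an embedding of
  rational quadratic spaces, proof of Prop. 2.5 [p0009:L38]; `q` = minus the intersection form on BOTH
  sides [p0008:L3], so "multiplier `p`" holds equally for the intersection forms).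
* [GS07] A. Garbagnati, A. Sarti, J. Algebra 318 (2007), Thm. 5.1 (`(E₈(−2))^⊥ = U³ ⊕ E₈(−2)`,
  `(K₁₂(−2))^⊥ = U ⊕ U(3)² ⊕ A₂²`, the `A₂` negative definite).

## Rendering (tree carriers) and faithfulness

As in `K3SqrtThreeOfTranscendentalEmbedding.lean`: `X` a projective K3 surface (`IsK3Surface X`) with a
MARKING `(η, p)` (integral classes `↔ Λ = ℤ²²`, cup product `=` K3 form `• p`); the lattice criterion
as a `ℚ`-linear `ι : ℚ²² → ℚ^m` ISOMETRIC on the transcendental coordinate vectors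
(`IsTranscendentalCoord X η`) for a DIAGONAL avatar of `Γ_p ⊗ ℚ` and INJECTIVE there:
`Γ₂ ⊗ ℚ = (U³ ⊕ E₈(−2)) ⊗ ℚ ≅ ⟨1,1,1⟩ ⊕ ⟨−1⟩¹¹` (`U ⊗ ℚ ≅ ⟨1,−1⟩`; `E₈ ⊗ ℚ ≅ ⟨1⟩⁸` — even
unimodular positive definite, discriminant `1`, all Hasse invariants trivial; `⟨−2,−2⟩ ≅ ⟨−1,−1⟩`),
`Γ₃ ⊗ ℚ = (U³ ⊕ A₂²) ⊗ ℚ ≅ ⟨1,1,1,−1,−1,−1,−2,−6,−2,−6⟩` (as in the companion file). CONCLUSION: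
there exist a projective K3 surface `Y` with a marking `(η_Y, p_Y, x_Y)` (the clauses of
`Huybrechts_K3_marking_exists`, which every projective K3 surface satisfies) and an ALGEBRAIC class
`γ ∈ N²H⁴((X ⊗ Y)(ℂ); ℂ)` whose action `φ = [γ]_* = fst_*(snd^*(·) ∪ γ) : H²(Y(ℂ); ℂ) → H²(X(ℂ); ℂ)` (the
tree's `complexGysin` for the complex orientation family — LITERALLY the expression of
`Buskin2019_hodgeIsometry_algebraic` and `corrComp_K3_of_cup`) is rational, Hodge-type preserving, maps
`T(Y) = transcendentalSubspace Y` ONTO `T(X)`, and has multiplier `p` there in the markings: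
`(η φ a · η φ b) = p · (η_Y a · η_Y b)` for `a, b ∈ T(Y)`. ("Hodge similarity" in [Var23] §1 is a
Hodge isomorphism scaling the forms; `φ = β_*π^*` is bijective on `T ⊗ ℚ` since `π_*π^* = p` and
`σ_p` acts trivially on `T(X)`.) WEAKER-OR-EQUAL THAN PRINT: existence only; nothing on `p ∉ {2, 3}`,
on `Y`'s Picard lattice, or on the Hodge conjecture.

## Content and D-0026 accounting

TWO named facts (+2; absent before: `lean search 'quotientSimilitude|β_\*π|multiplier'` finds only the
two companion records, whose conclusions live on one surface), no
definition with body, no instance, no notation, no sorry (statement-only file).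
-/

noncomputable section

open CategoryTheory MonoidalCategory
open Literature.AlgebraicTopology.SingularHomology

namespace Literature.AlgebraicGeometry.Surfaces

open HodgeTheory

/-- **Varesco 2023 §2 (starting observation) with Thm. 2.1 (first step) and Prop. 2.5, `p = 2` — an
algebraic Hodge similitude of multiplier `2` onto `T(X)` from another projective K3 surface, for every
projective K3 surface `X` with `T(X)_ℚ ↪ (U³ ⊕ E₈(−2)) ⊗ ℚ ≅ ⟨1,1,1⟩ ⊕ ⟨−1⟩¹¹`.** Print: "given a K3
surface `X` with a symplectic automorphism of order `p`, there exists a K3 surface `Y` and an algebraic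
Hodge similarity `φ : T(Y) → T(X)` of multiplier `p`" (`φ = β_*π^*`, `Y` the minimal resolution of
`X/σ_p`); "Hodge isometries of K3 surfaces are algebraic [Buskin, Huybrechts]" (first step of the proof of
Thm. 2.1); Prop. 2.5: "`X` is Hodge isometric to a K3 surface admitting a Nikulin involution if and only if
`T(X) ⊆ U³_ℚ ⊕ E₈(−2)_ℚ`". Rendering (module docstring): through a marking `(η, p)` of `X` and a `ℚ`-linear
`ι : ℚ²² → ℚ^14` isometric on the transcendental coordinate vectors for the weights `[1, 1, 1, -1, -1, -1, -1, -1, -1, -1, -1, -1, -1, -1]` and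
injective there, there are a marked projective K3 surface `(Y, η_Y, p_Y, x_Y)`, a `ℂ`-linear `φ` and an
algebraic class `γ` on `X ⊗ Y` with `φ = fst_*(snd^*(·) ∪ γ)` (complex orientations), `φ` rational and
type-preserving, mapping `transcendentalSubspace Y` onto `transcendentalSubspace X`, with
`(ηφa · ηφb) = 2 (η_Y a · η_Y b)` there. A THEOREM in print (REFEREED, Math. Z. 2023; unproved in the tree).
[cite: Varesco2023, §2 (p0008:L12–L28), Thm. 2.1 (proof, p0008:L35) and Prop. 2.5]
[cite: GarbagnatiSarti2007, Thm. 5.1 (`p = 2`)] [cite: Buskin2019, Thm. 1.1] -/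
def Varesco2023_quotientSimilitude_two_of_transcendental_embedding : Prop :=
  ∀ ⦃X : Motives.SchemeOver ℂ⦄ (hX : IsK3Surface X)
    (η : complexBetti X (2 * 1) ≃ₗ[ℂ] (K3Index → ℂ)) (p : complexBetti X (2 * 2)),
    p ≠ 0 → IsIntegralClass p →
    (∀ q : complexBetti X (2 * 2), IsIntegralClass q → ∃ n : ℤ, q = n • p) →
    (∀ c : complexBetti X (2 * 1), IsIntegralClass c ↔ ∃ v : K3Index → ℤ, η c = fun i => (v i : ℂ)) →
    (∀ a b : complexBetti X (2 * 1),
      cupProduct (rfl : 2 * 1 + 2 * 1 = 2 * 2) a b = k3Form (η a) (η b) • p) →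
  ∀ (ι : (K3Index → ℚ) →ₗ[ℚ] (Fin 14 → ℚ)),
    (∀ v w : K3Index → ℚ, IsTranscendentalCoord X η v → IsTranscendentalCoord X η w →
      ∑ i : Fin 14, (![1, 1, 1, -1, -1, -1, -1, -1, -1, -1, -1, -1, -1, -1] : Fin 14 → ℚ) i * ι v i * ι w i =
        k3FormRat v w) →
    (∀ v : K3Index → ℚ, IsTranscendentalCoord X η v → ι v = 0 → v = 0) →
  ∃ (Y : Motives.SchemeOver ℂ) (hY : IsK3Surface Y)
    (ηY : complexBetti Y (2 * 1) ≃ₗ[ℂ] (K3Index → ℂ)) (pY : complexBetti Y (2 * 2)) (xY : K3Index → ℂ),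
    (pY ≠ 0 ∧ (IsIntegralClass pY ∧
      (∀ q : complexBetti Y (2 * 2), IsIntegralClass q → ∃ n : ℤ, q = n • pY) ∧
      (∀ c : complexBetti Y (2 * 1), IsIntegralClass c ↔ ∃ v : K3Index → ℤ, ηY c = fun i => (v i : ℂ)) ∧
      (∀ a b : complexBetti Y (2 * 1),
        cupProduct (rfl : 2 * 1 + 2 * 1 = 2 * 2) a b = k3Form (ηY a) (ηY b) • pY) ∧
      IsOfHodgeType 2 Y (2 * 1) 2 0 (LinearEquiv.symm ηY xY) ∧
      (∀ τ : complexBetti Y (2 * 1), IsOfHodgeType 2 Y (2 * 1) 2 0 τ →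
        ∃ t : ℂ, τ = t • LinearEquiv.symm ηY xY)) ∧
      (k3Form xY xY = 0 ∧ 0 < (k3Form (star xY) xY).re ∧
        ∃ u : K3Index → ℤ, k3Form (fun i => (u i : ℂ)) xY = 0 ∧ 0 < ∑ i, ∑ j, u i * k3Gram i j * u j)) ∧
    ∃ (φ : complexBetti Y (2 * 1) →ₗ[ℂ] complexBetti X (2 * 1)) (γ : complexBetti (X ⊗ Y) (2 * 2)),
      γ ∈ algebraicClasses (X ⊗ Y) 2 ∧
      (∀ y : complexBetti Y (2 * 1), φ y =
        complexGysin complexOrientationFamily (Motives.IsSmoothProjective.tensor_holds hX.1 hY.1) hX.1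
          (SemiCartesianMonoidalCategory.fst X Y) (rfl : 2 * 1 + 2 * 2 + 2 * 2 = 2 * 1 + 2 * (2 + 2))
          (cupProduct (rfl : 2 * 1 + 2 * 2 = 2 * 1 + 2 * 2)
            (complexBetti.map (SemiCartesianMonoidalCategory.snd X Y) (2 * 1) y) γ)) ∧
      (∀ y : complexBetti Y (2 * 1), IsRationalClass y → IsRationalClass (φ y)) ∧
      (∀ (i j : ℕ) (y : complexBetti Y (2 * 1)), IsOfHodgeType 2 Y (2 * 1) i j y →
        IsOfHodgeType 2 X (2 * 1) i j (φ y)) ∧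
      (∀ y ∈ transcendentalSubspace Y, φ y ∈ transcendentalSubspace X) ∧
      (∀ x ∈ transcendentalSubspace X, ∃ y ∈ transcendentalSubspace Y, φ y = x) ∧
      (∀ a ∈ transcendentalSubspace Y, ∀ b ∈ transcendentalSubspace Y,
        k3Form (η (φ a)) (η (φ b)) = 2 * k3Form (ηY a) (ηY b))

/-- **Varesco 2023 §2 (starting observation) with Thm. 2.1 (first step) and Prop. 2.11, `p = 3` — an
algebraic Hodge similitude of multiplier `3` onto `T(X)` from another projective K3 surface, for every
projective K3 surface `X` with `T(X)_ℚ ↪ (U³ ⊕ A₂²) ⊗ ℚ ≅ ⟨1,1,1,−1,−1,−1,−2,−6,−2,−6⟩`.** Print: "given a K3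
surface `X` with a symplectic automorphism of order `p`, there exists a K3 surface `Y` and an algebraic
Hodge similarity `φ : T(Y) → T(X)` of multiplier `p`" (`φ = β_*π^*`, `Y` the minimal resolution of
`X/σ_p`); "Hodge isometries of K3 surfaces are algebraic [Buskin, Huybrechts]" (first step of the proof of
Thm. 2.1); Prop. 2.11: "`X` is Hodge isometric to a K3 surface admitting a symplectic automorphism of order `3` if and only if
`T(X) ⊆ U³_ℚ ⊕ (A₂)²_ℚ`". Rendering (module docstring): through a marking `(η, p)` of `X` and a `ℚ`-linear
`ι : ℚ²² → ℚ^10` isometric on the transcendental coordinate vectors for the weights `[1, 1, 1, -1, -1, -1, -2, -6, -2, -6]` and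
injective there, there are a marked projective K3 surface `(Y, η_Y, p_Y, x_Y)`, a `ℂ`-linear `φ` and an
algebraic class `γ` on `X ⊗ Y` with `φ = fst_*(snd^*(·) ∪ γ)` (complex orientations), `φ` rational and
type-preserving, mapping `transcendentalSubspace Y` onto `transcendentalSubspace X`, with
`(ηφa · ηφb) = 3 (η_Y a · η_Y b)` there. A THEOREM in print (REFEREED, Math. Z. 2023; unproved in the tree).
[cite: Varesco2023, §2 (p0008:L12–L28), Thm. 2.1 (proof, p0008:L35) and Prop. 2.11]
[cite: GarbagnatiSarti2007, Thm. 5.1 (`p = 3`)] [cite: Buskin2019, Thm. 1.1] -/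
def Varesco2023_quotientSimilitude_three_of_transcendental_embedding : Prop :=
  ∀ ⦃X : Motives.SchemeOver ℂ⦄ (hX : IsK3Surface X)
    (η : complexBetti X (2 * 1) ≃ₗ[ℂ] (K3Index → ℂ)) (p : complexBetti X (2 * 2)),
    p ≠ 0 → IsIntegralClass p →
    (∀ q : complexBetti X (2 * 2), IsIntegralClass q → ∃ n : ℤ, q = n • p) →
    (∀ c : complexBetti X (2 * 1), IsIntegralClass c ↔ ∃ v : K3Index → ℤ, η c = fun i => (v i : ℂ)) →
    (∀ a b : complexBetti X (2 * 1),
      cupProduct (rfl : 2 * 1 + 2 * 1 = 2 * 2) a b = k3Form (η a) (η b) • p) →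
  ∀ (ι : (K3Index → ℚ) →ₗ[ℚ] (Fin 10 → ℚ)),
    (∀ v w : K3Index → ℚ, IsTranscendentalCoord X η v → IsTranscendentalCoord X η w →
      ∑ i : Fin 10, (![1, 1, 1, -1, -1, -1, -2, -6, -2, -6] : Fin 10 → ℚ) i * ι v i * ι w i =
        k3FormRat v w) →
    (∀ v : K3Index → ℚ, IsTranscendentalCoord X η v → ι v = 0 → v = 0) →
  ∃ (Y : Motives.SchemeOver ℂ) (hY : IsK3Surface Y)
    (ηY : complexBetti Y (2 * 1) ≃ₗ[ℂ] (K3Index → ℂ)) (pY : complexBetti Y (2 * 2)) (xY : K3Index → ℂ),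
    (pY ≠ 0 ∧ (IsIntegralClass pY ∧
      (∀ q : complexBetti Y (2 * 2), IsIntegralClass q → ∃ n : ℤ, q = n • pY) ∧
      (∀ c : complexBetti Y (2 * 1), IsIntegralClass c ↔ ∃ v : K3Index → ℤ, ηY c = fun i => (v i : ℂ)) ∧
      (∀ a b : complexBetti Y (2 * 1),
        cupProduct (rfl : 2 * 1 + 2 * 1 = 2 * 2) a b = k3Form (ηY a) (ηY b) • pY) ∧
      IsOfHodgeType 2 Y (2 * 1) 2 0 (LinearEquiv.symm ηY xY) ∧
      (∀ τ : complexBetti Y (2 * 1), IsOfHodgeType 2 Y (2 * 1) 2 0 τ →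
        ∃ t : ℂ, τ = t • LinearEquiv.symm ηY xY)) ∧
      (k3Form xY xY = 0 ∧ 0 < (k3Form (star xY) xY).re ∧
        ∃ u : K3Index → ℤ, k3Form (fun i => (u i : ℂ)) xY = 0 ∧ 0 < ∑ i, ∑ j, u i * k3Gram i j * u j)) ∧
    ∃ (φ : complexBetti Y (2 * 1) →ₗ[ℂ] complexBetti X (2 * 1)) (γ : complexBetti (X ⊗ Y) (2 * 2)),
      γ ∈ algebraicClasses (X ⊗ Y) 2 ∧
      (∀ y : complexBetti Y (2 * 1), φ y =
        complexGysin complexOrientationFamily (Motives.IsSmoothProjective.tensor_holds hX.1 hY.1) hX.1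
          (SemiCartesianMonoidalCategory.fst X Y) (rfl : 2 * 1 + 2 * 2 + 2 * 2 = 2 * 1 + 2 * (2 + 2))
          (cupProduct (rfl : 2 * 1 + 2 * 2 = 2 * 1 + 2 * 2)
            (complexBetti.map (SemiCartesianMonoidalCategory.snd X Y) (2 * 1) y) γ)) ∧
      (∀ y : complexBetti Y (2 * 1), IsRationalClass y → IsRationalClass (φ y)) ∧
      (∀ (i j : ℕ) (y : complexBetti Y (2 * 1)), IsOfHodgeType 2 Y (2 * 1) i j y →
        IsOfHodgeType 2 X (2 * 1) i j (φ y)) ∧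
      (∀ y ∈ transcendentalSubspace Y, φ y ∈ transcendentalSubspace X) ∧
      (∀ x ∈ transcendentalSubspace X, ∃ y ∈ transcendentalSubspace Y, φ y = x) ∧
      (∀ a ∈ transcendentalSubspace Y, ∀ b ∈ transcendentalSubspace Y,
        k3Form (η (φ a)) (η (φ b)) = 3 * k3Form (ηY a) (ηY b))

end Literature.AlgebraicGeometry.Surfaces

end
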